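import Summits.KontsevichZagierPeriods.Zeta5Search.Barrier.ConeGammaRates

/-!
# ζ(5) search — BARRIER: the critical system under the `S₇` generator `s₅ ↔ s₆` — algebraic core

HONEST FRAMING (cell `pub-zeta5`): systematic search; no irrationality claim unless kernel-certified. MODEL objects
under Brown–Zudilin's (28)+(30) accounting ([BZ22] = arXiv:2210.03391; (28) observed, not proved); this file is pure
polynomial algebra about BZ's §5 critical system `F₁ = F₂ = 0` (tree: `ConeGammaRates.F1R/F2R/IsCritical`); nothing
here is a statement about `ζ(5)`, the cone's supremum (C2 = `BarrierC2`, OPEN) or S-E (CONJECTURED). No number or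
sentence of record moves. Records in print UNMOVED. Prover P2 g21 (self-selected Lean-only item, file 1).

In the SHIFTED coordinates `X = x − s₆`, `Y = y − s₆` of a direction with symmetric parameters `s = (s₀; s₁,…,s₇)`
(`(p;q)` of (11): `p = (s₄+s₆, s₃+s₆, s₅+s₆, s₀+s₆, s₆+s₇, s₂+s₆, s₁+s₆)`, `q = (s₀−s₃, s₃+s₄, s₁+s₄, s₁+s₂, s₀−s₂)`)
BZ's system reads
`F₁ = (X+s₆)(s₀−X)(s₃+s₄+s₅−X)(X+Y) − (X−s₃)(X−s₄)(X−s₅)(X+Y+s₆−s₀)`,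
`F₂ = (Y+s₆)(s₁+s₂+s₇−Y)(s₀−Y)(X+Y) − (X+Y+s₆−s₀)(Y−s₁)(Y−s₂)(Y−s₇)`:
an `x`-block `{s₃,s₄,s₅}`, a `y`-block `{s₁,s₂,s₇}`, and the special parameter `s₆`. With
`M = (s₁+s₂+s₇−Y)(s₀−Y)`, `P = (Y−s₁)(Y−s₂)(Y−s₇)`, `Q_c = (Y+c)M − P`:
* `swapF2_eq` — `F₂ = (X+Y)·Q_{s₆} − (s₆−s₀)·P` (so `F₂ = 0` says `X·Q = (s₆−s₀)P − Y·Q`);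
* `swapF1_mul_pow` — `F₁·Q⁴` is a polynomial `Φ` in `Z = X·Q`;
* **`swapPhi_eq`** — the RESOLVENT IDENTITY `Φ((c−s₀)P − YQ_c) = (c−s₀)(Y+c)Q_c²·D`, where the quartic
  `D(Y) = E·M² − B·M·P + (Y−s₀)(Y−s₀+σ₁)·P²` (`E = Π_{j∈{3,4,c,d}}(Y+s_j)`, `σ_k` the elementary symmetric
  functions of `{s₃,s₄,c,d}`) is SYMMETRIC in `(c,d) = (s₆,s₅)`: the critical `Y`'s of a direction and of its
  `s₅ ↔ s₆` swap are roots of the SAME quartic;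
* `swapG3_eq`, `swapG5_eq`, `swapG0_eq` — the three «group identities» behind the shift of the growth functional
  (cofactors `(s₅−s₆)`, `−1`, `0` of `D`);
* **`swap_D_eq_zero`**, **`swap_F1_transfer`**, `swap_F2_transfer` — at a solution of `F₁ = F₂ = 0` with `P ≠ 0`,
  `s₆ ≠ s₀`: `D(Y) = 0`; and the MÖBIUS image `X′` defined by `(X′+Y)·Q_{s₅} = (s₅−s₀)·P` (same `Y`) solves the
  swapped system (`x`-block `{s₃,s₄,s₆}`, special `s₅`).
All statements are identities/implications between real numbers (`ring` after substitution); the packaging into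
`IsCritical`/`critVals`/`permAct (Equiv.swap 4 5)` and the growth shift are in the companion files.
-/

noncomputable section

namespace Summit.KontsevichZagierPeriods.Zeta5Search.Barrier.ConeGamma

/-! ### Universal identities -/

/-- `F₂` in shifted coordinates is LINEAR in `X`: `F₂ = (X+Y)·Q − (c−s₀)·P` with `Q = (Y+c)M − P`. -/
theorem swapF2_eq (X Y M P Q s0 s1 s2 s7 c : ℝ) (hM : M = (s1 + s2 + s7 - Y) * (s0 - Y))
    (hP : P = (Y - s1) * (Y - s2) * (Y - s7)) (hQ : Q = (Y + c) * M - P) :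
    (Y + c) * (s1 + s2 + s7 - Y) * (s0 - Y) * (X + Y) - (X + Y + c - s0) * (Y - s1) * (Y - s2) * (Y - s7)
      = (X + Y) * Q - (c - s0) * P := by
  subst hQ hM hP; ring

/-- `F₁·Q⁴` is a polynomial `Φ` in `Z = X·Q` (no hypothesis on `Q`). -/
theorem swapF1_mul_pow (X Y Q Z s0 s3 s4 c d : ℝ) (h : X * Q = Z) :
    ((X + c) * (s0 - X) * (s3 + s4 + d - X) * (X + Y) - (X - s3) * (X - s4) * (X - d) * (X + Y + c - s0)) * Q ^ 4
      = (Z + c * Q) * (s0 * Q - Z) * ((s3 + s4 + d) * Q - Z) * (Z + Y * Q)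
        - (Z - s3 * Q) * (Z - s4 * Q) * (Z - d * Q) * (Z + Y * Q + (c - s0) * Q) := by
  subst h; ring

/-- **The resolvent identity.** At `Z = (c−s₀)P − Y·Q_c` (the value of `X·Q_c` forced by `F₂ = 0`),
`Φ(Z) = (c−s₀)·(Y+c)·Q_c²·D` with the quartic `D` symmetric under `c ↔ d`. -/
theorem swapPhi_eq (Y M P Q s0 s3 s4 c d : ℝ) (hQ : Q = (Y + c) * M - P) :
    (((c - s0) * P - Y * Q) + c * Q) * (s0 * Q - ((c - s0) * P - Y * Q))
        * ((s3 + s4 + d) * Q - ((c - s0) * P - Y * Q)) * (((c - s0) * P - Y * Q) + Y * Q)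
      - (((c - s0) * P - Y * Q) - s3 * Q) * (((c - s0) * P - Y * Q) - s4 * Q) * (((c - s0) * P - Y * Q) - d * Q)
        * (((c - s0) * P - Y * Q) + Y * Q + (c - s0) * Q)
      = (c - s0) * ((Y + c) * Q ^ 2 *
        ((Y + s3) * (Y + s4) * (Y + c) * (Y + d) * M ^ 2
        - (2 * Y ^ 3 - 2 * (s0 - (s3 + s4 + c + d)) * Y ^ 2 - (s0 * (s3 + s4 + c + d)
            - (s3 * s4 + s3 * c + s3 * d + s4 * c + s4 * d + c * d)) * Y
            - (s0 * (s3 * s4 + s3 * c + s3 * d + s4 * c + s4 * d + c * d)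
              - (s3 * s4 * c + s3 * s4 * d + s3 * c * d + s4 * c * d))) * M * P
        + (Y - s0) * (Y - s0 + (s3 + s4 + c + d)) * P ^ 2)) := by
  subst hQ; ring

/-- **Group identity G3/G4** (instantiate `(e, e') = (s₃, s₄)` or `(s₄, s₃)`): cofactor `(s₅ − s₆)` of `D`. -/
theorem swapG3_eq (Y M P Q5 Q6 s0 e e' s5 s6 : ℝ) (hQ5 : Q5 = (Y + s5) * M - P) (hQ6 : Q6 = (Y + s6) * M - P) :
    (((s5 - s0) * P - Y * Q5) - e * Q5) * ((e + e' + s5) * Q6 - ((s6 - s0) * P - Y * Q6)) * (e + s6)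
      - ((e + e' + s6) * Q5 - ((s5 - s0) * P - Y * Q5)) * (((s6 - s0) * P - Y * Q6) - e * Q6) * (e + s5)
      = (s5 - s6) *
        ((Y + e) * (Y + e') * (Y + s6) * (Y + s5) * M ^ 2
        - (2 * Y ^ 3 - 2 * (s0 - (e + e' + s6 + s5)) * Y ^ 2 - (s0 * (e + e' + s6 + s5)
            - (e * e' + e * s6 + e * s5 + e' * s6 + e' * s5 + s6 * s5)) * Y
            - (s0 * (e * e' + e * s6 + e * s5 + e' * s6 + e' * s5 + s6 * s5)
              - (e * e' * s6 + e * e' * s5 + e * s6 * s5 + e' * s6 * s5))) * M * P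
        + (Y - s0) * (Y - s0 + (e + e' + s6 + s5)) * P ^ 2) := by
  subst hQ5 hQ6; ring

/-- **Group identity G5/G6** (instantiate `(c, c') = (s₅, s₆)` or `(s₆, s₅)`): `… = −D`. -/
theorem swapG5_eq (Y M P Qc Qc' s0 s3 s4 c c' : ℝ) (hQc : Qc = (Y + c) * M - P) (hQc' : Qc' = (Y + c') * M - P) :
    (((c - s0) * P - Y * Qc) + c * Qc) * ((s3 + s4 + c) * Qc' - ((c' - s0) * P - Y * Qc'))
      + M * (((c' - s0) * P - Y * Qc') - c * Qc') * (s3 + c) * (s4 + c)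
      = -((Y + s3) * (Y + s4) * (Y + c') * (Y + c) * M ^ 2
        - (2 * Y ^ 3 - 2 * (s0 - (s3 + s4 + c' + c)) * Y ^ 2 - (s0 * (s3 + s4 + c' + c)
            - (s3 * s4 + s3 * c' + s3 * c + s4 * c' + s4 * c + c' * c)) * Y
            - (s0 * (s3 * s4 + s3 * c' + s3 * c + s4 * c' + s4 * c + c' * c)
              - (s3 * s4 * c' + s3 * s4 * c + s3 * c' * c + s4 * c' * c))) * M * P
        + (Y - s0) * (Y - s0 + (s3 + s4 + c' + c)) * P ^ 2) := by
  subst hQc hQc'; ring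

/-- **Group identity G0** (the `s₀`-coefficient): holds identically. -/
theorem swapG0_eq (Y M P Q5 Q6 s0 s5 s6 : ℝ) (hQ5 : Q5 = (Y + s5) * M - P) (hQ6 : Q6 = (Y + s6) * M - P) :
    (s5 - s0) * (P + Q5) * (s0 * Q6 - ((s6 - s0) * P - Y * Q6)) * (s0 - s6)
      = (s0 * Q5 - ((s5 - s0) * P - Y * Q5)) * ((s6 - s0) * (P + Q6)) * (s0 - s5) := by
  subst hQ5 hQ6; ring

/-! ### At a solution of `F₁ = F₂ = 0`: `D = 0`, and the Möbius image solves the swapped system -/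

/-- **`D(Y) = 0` at every solution of the shifted system** with `P ≠ 0` (i.e. `y ≠ p₄, p₅, p₆`), `y ≠ 0`
(`Y + s₆ ≠ 0`; at `y = 0` sits the trivial solution `(p₃, 0)` of (19)) and `s₆ ≠ s₀`. -/
theorem swap_D_eq_zero {X Y s0 s1 s2 s3 s4 s5 s6 s7 : ℝ}
    (hF1 : (X + s6) * (s0 - X) * (s3 + s4 + s5 - X) * (X + Y) - (X - s3) * (X - s4) * (X - s5) * (X + Y + s6 - s0) = 0)
    (hF2 : (Y + s6) * (s1 + s2 + s7 - Y) * (s0 - Y) * (X + Y) - (X + Y + s6 - s0) * (Y - s1) * (Y - s2) * (Y - s7) = 0)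
    (h06 : s6 ≠ s0) (hP : (Y - s1) * (Y - s2) * (Y - s7) ≠ 0) (hy : Y + s6 ≠ 0) :
    (Y + s3) * (Y + s4) * (Y + s6) * (Y + s5) * ((s1 + s2 + s7 - Y) * (s0 - Y)) ^ 2
        - (2 * Y ^ 3 - 2 * (s0 - (s3 + s4 + s6 + s5)) * Y ^ 2 - (s0 * (s3 + s4 + s6 + s5)
            - (s3 * s4 + s3 * s6 + s3 * s5 + s4 * s6 + s4 * s5 + s6 * s5)) * Y
            - (s0 * (s3 * s4 + s3 * s6 + s3 * s5 + s4 * s6 + s4 * s5 + s6 * s5)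
              - (s3 * s4 * s6 + s3 * s4 * s5 + s3 * s6 * s5 + s4 * s6 * s5)))
          * ((s1 + s2 + s7 - Y) * (s0 - Y)) * ((Y - s1) * (Y - s2) * (Y - s7))
        + (Y - s0) * (Y - s0 + (s3 + s4 + s6 + s5)) * ((Y - s1) * (Y - s2) * (Y - s7)) ^ 2 = 0 := by
  set M := (s1 + s2 + s7 - Y) * (s0 - Y) with hM
  set P := (Y - s1) * (Y - s2) * (Y - s7) with hP'
  set Q := (Y + s6) * M - P with hQ
  have hF2' : (X + Y) * Q - (s6 - s0) * P = 0 := by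
    rw [← swapF2_eq X Y M P Q s0 s1 s2 s7 s6 hM hP' hQ]; exact hF2
  have hXQ : X * Q = (s6 - s0) * P - Y * Q := by linear_combination hF2'
  have hQne : Q ≠ 0 := by
    intro hQ0
    have : (s6 - s0) * P = 0 := by linear_combination (X + Y) * hQ0 - hF2'
    rcases mul_eq_zero.mp this with h | h
    · exact h06 (by linear_combination h)
    · exact hP h
  have key := swapF1_mul_pow X Y Q _ s0 s3 s4 s6 s5 hXQ
  rw [hF1, zero_mul] at key
  rw [swapPhi_eq Y M P Q s0 s3 s4 s6 s5 hQ] at key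
  have hc : (s6 - s0) * ((Y + s6) * Q ^ 2) ≠ 0 :=
    mul_ne_zero (sub_ne_zero.mpr h06) (mul_ne_zero hy (pow_ne_zero 2 hQne))
  have key' := key.symm
  rw [show ∀ D : ℝ, (s6 - s0) * ((Y + s6) * Q ^ 2 * D) = (s6 - s0) * ((Y + s6) * Q ^ 2) * D from
    fun D => by ring] at key'
  exact (mul_eq_zero.mp key').resolve_left hc

/-- **Transfer of `F₁`.** Under the hypotheses of `swap_D_eq_zero` and `s₅ ≠ s₀`, the Möbius image `X′` defined
by `(X′+Y)·Q_{s₅} = (s₅−s₀)·P` (same `Y`) satisfies the SWAPPED first equation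
(`x`-block `{s₃,s₄,s₆}`, special parameter `s₅`). -/
theorem swap_F1_transfer {X Y X' s0 s1 s2 s3 s4 s5 s6 s7 : ℝ}
    (hF1 : (X + s6) * (s0 - X) * (s3 + s4 + s5 - X) * (X + Y) - (X - s3) * (X - s4) * (X - s5) * (X + Y + s6 - s0) = 0)
    (hF2 : (Y + s6) * (s1 + s2 + s7 - Y) * (s0 - Y) * (X + Y) - (X + Y + s6 - s0) * (Y - s1) * (Y - s2) * (Y - s7) = 0)
    (h06 : s6 ≠ s0) (h05 : s5 ≠ s0) (hP : (Y - s1) * (Y - s2) * (Y - s7) ≠ 0) (hy : Y + s6 ≠ 0)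
    (hX' : (X' + Y) * ((Y + s5) * ((s1 + s2 + s7 - Y) * (s0 - Y)) - (Y - s1) * (Y - s2) * (Y - s7))
      = (s5 - s0) * ((Y - s1) * (Y - s2) * (Y - s7))) :
    (X' + s5) * (s0 - X') * (s3 + s4 + s6 - X') * (X' + Y) - (X' - s3) * (X' - s4) * (X' - s6) * (X' + Y + s5 - s0)
      = 0 := by
  have hD := swap_D_eq_zero hF1 hF2 h06 hP hy
  set M := (s1 + s2 + s7 - Y) * (s0 - Y) with hM
  set P := (Y - s1) * (Y - s2) * (Y - s7) with hP'
  set Q5 := (Y + s5) * M - P with hQ5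
  have hQ5ne : Q5 ≠ 0 := by
    intro h0
    have : (s5 - s0) * P = 0 := by rw [← hX', h0, mul_zero]
    rcases mul_eq_zero.mp this with h | h
    · exact h05 (by linear_combination h)
    · exact hP h
  have hXQ : X' * Q5 = (s5 - s0) * P - Y * Q5 := by linear_combination hX'
  have key := swapF1_mul_pow X' Y Q5 _ s0 s3 s4 s5 s6 hXQ
  rw [swapPhi_eq Y M P Q5 s0 s3 s4 s5 s6 hQ5] at key
  have hD' : (Y + s3) * (Y + s4) * (Y + s5) * (Y + s6) * M ^ 2
        - (2 * Y ^ 3 - 2 * (s0 - (s3 + s4 + s5 + s6)) * Y ^ 2 - (s0 * (s3 + s4 + s5 + s6)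
            - (s3 * s4 + s3 * s5 + s3 * s6 + s4 * s5 + s4 * s6 + s5 * s6)) * Y
            - (s0 * (s3 * s4 + s3 * s5 + s3 * s6 + s4 * s5 + s4 * s6 + s5 * s6)
              - (s3 * s4 * s5 + s3 * s4 * s6 + s3 * s5 * s6 + s4 * s5 * s6))) * M * P
        + (Y - s0) * (Y - s0 + (s3 + s4 + s5 + s6)) * P ^ 2 = 0 := by
    linear_combination hD
  rw [hD'] at key
  simp only [mul_zero] at key
  exact (mul_eq_zero.mp key).resolve_right (pow_ne_zero 4 hQ5ne)

/-- **Transfer of `F₂`** (by construction of the Möbius image). -/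
theorem swap_F2_transfer {Y X' s0 s1 s2 s5 s7 : ℝ}
    (hX' : (X' + Y) * ((Y + s5) * ((s1 + s2 + s7 - Y) * (s0 - Y)) - (Y - s1) * (Y - s2) * (Y - s7))
      = (s5 - s0) * ((Y - s1) * (Y - s2) * (Y - s7))) :
    (Y + s5) * (s1 + s2 + s7 - Y) * (s0 - Y) * (X' + Y) - (X' + Y + s5 - s0) * (Y - s1) * (Y - s2) * (Y - s7)
      = 0 := by
  linear_combination hX'

/-- **The five product identities behind the growth shift** (one per coefficient `s₀, s₃, s₄, s₅, s₆`; those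
of `s₁, s₂, s₇` are trivial), at a solution of the shifted system with Möbius image `X′`:
`v₃′v₄(s₀−s₆) = v₄′v₃(s₀−s₅)`, `v₁′v₅(s₃+s₆) = v₅′v₁(s₃+s₅)`, `v₀′v₅(s₄+s₆) = v₅′v₀(s₄+s₅)`,
`x′·P·v₅·(s₀−s₅) = W′·M·v₂·(s₃+s₅)(s₄+s₅)`, `x·P·v₅′·(s₀−s₆) = W·M·v₂′·(s₃+s₆)(s₄+s₆)`
(`M = (s₁+s₂+s₇−Y)(s₀−Y) = v₁₀v₁₁`, `P = (Y−s₁)(Y−s₂)(Y−s₇) = v₉v₈v₇`, `W = X+Y`, `x = X+s₆`, `x′ = X′+s₅`). -/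
theorem swap_group_identities {X Y X' s0 s1 s2 s3 s4 s5 s6 s7 : ℝ}
    (hF1 : (X + s6) * (s0 - X) * (s3 + s4 + s5 - X) * (X + Y) - (X - s3) * (X - s4) * (X - s5) * (X + Y + s6 - s0) = 0)
    (hF2 : (Y + s6) * (s1 + s2 + s7 - Y) * (s0 - Y) * (X + Y) - (X + Y + s6 - s0) * (Y - s1) * (Y - s2) * (Y - s7) = 0)
    (h06 : s6 ≠ s0) (h05 : s5 ≠ s0) (hP : (Y - s1) * (Y - s2) * (Y - s7) ≠ 0) (hy : Y + s6 ≠ 0)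
    (hX' : (X' + Y) * ((Y + s5) * ((s1 + s2 + s7 - Y) * (s0 - Y)) - (Y - s1) * (Y - s2) * (Y - s7))
      = (s5 - s0) * ((Y - s1) * (Y - s2) * (Y - s7))) :
    (X' + Y + s5 - s0) * (s0 - X) * (s0 - s6) = (s0 - X') * (X + Y + s6 - s0) * (s0 - s5)
    ∧ (X' - s3) * (s3 + s4 + s5 - X) * (s3 + s6) = (s3 + s4 + s6 - X') * (X - s3) * (s3 + s5)
    ∧ (X' - s4) * (s3 + s4 + s5 - X) * (s4 + s6) = (s3 + s4 + s6 - X') * (X - s4) * (s4 + s5)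
    ∧ (X' + s5) * ((Y - s1) * (Y - s2) * (Y - s7)) * (s3 + s4 + s5 - X) * (s0 - s5)
        = (X' + Y) * ((s1 + s2 + s7 - Y) * (s0 - Y)) * (X - s5) * ((s3 + s5) * (s4 + s5))
    ∧ (X + s6) * ((Y - s1) * (Y - s2) * (Y - s7)) * (s3 + s4 + s6 - X') * (s0 - s6)
        = (X + Y) * ((s1 + s2 + s7 - Y) * (s0 - Y)) * (X' - s6) * ((s3 + s6) * (s4 + s6)) := by
  have hD := swap_D_eq_zero hF1 hF2 h06 hP hy
  set M := (s1 + s2 + s7 - Y) * (s0 - Y) with hM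
  set P := (Y - s1) * (Y - s2) * (Y - s7) with hP'
  set Q5 := (Y + s5) * M - P with hQ5
  set Q6 := (Y + s6) * M - P with hQ6
  have hF2' : (X + Y) * Q6 - (s6 - s0) * P = 0 := by
    rw [← swapF2_eq X Y M P Q6 s0 s1 s2 s7 s6 hM hP' hQ6]; exact hF2
  clear_value Q5 Q6 P M
  have hQ6ne : Q6 ≠ 0 := by
    intro h0
    have : (s6 - s0) * P = 0 := by linear_combination (X + Y) * h0 - hF2'
    rcases mul_eq_zero.mp this with h | h
    · exact h06 (by linear_combination h)
    · exact hP h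
  have hQ5ne : Q5 ≠ 0 := by
    intro h0
    have : (s5 - s0) * P = 0 := by rw [← hX', h0, mul_zero]
    rcases mul_eq_zero.mp this with h | h
    · exact h05 (by linear_combination h)
    · exact hP h
  have hQQ : Q5 * Q6 ≠ 0 := mul_ne_zero hQ5ne hQ6ne
  have hXQ6 : (s6 - s0) * P - Y * Q6 = X * Q6 := by linear_combination -hF2'
  have hXQ5 : (s5 - s0) * P - Y * Q5 = X' * Q5 := by linear_combination -hX'
  refine ⟨?_, ?_, ?_, ?_, ?_⟩
  · -- G0: identically (`swapG0_eq`), pulled back along `Q5·v₃′ = (s₅−s₀)(P+Q5)`, `Q6·v₃ = (s₆−s₀)(P+Q6)`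
    have key := swapG0_eq Y M P Q5 Q6 s0 s5 s6 hQ5 hQ6
    rw [hXQ5, hXQ6] at key
    have : Q5 * Q6 * ((X' + Y + s5 - s0) * (s0 - X) * (s0 - s6) - (s0 - X') * (X + Y + s6 - s0) * (s0 - s5))
        = 0 := by
      linear_combination key + (s0 * Q6 - X * Q6) * (s0 - s6) * hX' - (s0 * Q5 - X' * Q5) * (s0 - s5) * hF2'
    have := (mul_eq_zero.mp this).resolve_left hQQ
    linear_combination this
  · have key := swapG3_eq Y M P Q5 Q6 s0 s3 s4 s5 s6 hQ5 hQ6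
    rw [hD, mul_zero, hXQ5, hXQ6] at key
    have : Q5 * Q6 * ((X' - s3) * (s3 + s4 + s5 - X) * (s3 + s6) - (s3 + s4 + s6 - X') * (X - s3) * (s3 + s5))
        = 0 := by linear_combination key
    have := (mul_eq_zero.mp this).resolve_left hQQ
    linear_combination this
  · have key := swapG3_eq Y M P Q5 Q6 s0 s4 s3 s5 s6 hQ5 hQ6
    have hD' : (Y + s4) * (Y + s3) * (Y + s6) * (Y + s5) * M ^ 2
        - (2 * Y ^ 3 - 2 * (s0 - (s4 + s3 + s6 + s5)) * Y ^ 2 - (s0 * (s4 + s3 + s6 + s5)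
            - (s4 * s3 + s4 * s6 + s4 * s5 + s3 * s6 + s3 * s5 + s6 * s5)) * Y
            - (s0 * (s4 * s3 + s4 * s6 + s4 * s5 + s3 * s6 + s3 * s5 + s6 * s5)
              - (s4 * s3 * s6 + s4 * s3 * s5 + s4 * s6 * s5 + s3 * s6 * s5))) * M * P
        + (Y - s0) * (Y - s0 + (s4 + s3 + s6 + s5)) * P ^ 2 = 0 := by
      linear_combination hD
    rw [hD', mul_zero, hXQ5, hXQ6] at key
    have : Q5 * Q6 * ((X' - s4) * (s3 + s4 + s5 - X) * (s4 + s6) - (s3 + s4 + s6 - X') * (X - s4) * (s4 + s5))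
        = 0 := by linear_combination key
    have := (mul_eq_zero.mp this).resolve_left hQQ
    linear_combination this
  · have key := swapG5_eq Y M P Q5 Q6 s0 s3 s4 s5 s6 hQ5 hQ6
    have hD' : (Y + s3) * (Y + s4) * (Y + s6) * (Y + s5) * M ^ 2
        - (2 * Y ^ 3 - 2 * (s0 - (s3 + s4 + s6 + s5)) * Y ^ 2 - (s0 * (s3 + s4 + s6 + s5)
            - (s3 * s4 + s3 * s6 + s3 * s5 + s4 * s6 + s4 * s5 + s6 * s5)) * Y
            - (s0 * (s3 * s4 + s3 * s6 + s3 * s5 + s4 * s6 + s4 * s5 + s6 * s5)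
              - (s3 * s4 * s6 + s3 * s4 * s5 + s3 * s6 * s5 + s4 * s6 * s5))) * M * P
        + (Y - s0) * (Y - s0 + (s3 + s4 + s6 + s5)) * P ^ 2 = 0 := hD
    rw [hD', neg_zero, hXQ5, hXQ6] at key
    -- key : (X'Q5 + s5 Q5)((u+s5)Q6 − X Q6) + M (X Q6 − s5 Q6)(s3+s5)(s4+s5) = 0; and (X'+Y) Q5 = (s5−s0) P.
    have : Q5 * Q6 * ((X' + s5) * P * (s3 + s4 + s5 - X) * (s0 - s5)
        - (X' + Y) * M * (X - s5) * ((s3 + s5) * (s4 + s5))) = 0 := by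
      linear_combination (s0 - s5) * P * key - Q6 * M * (X - s5) * ((s3 + s5) * (s4 + s5)) * hX'
    have := (mul_eq_zero.mp this).resolve_left hQQ
    linear_combination this
  · have key := swapG5_eq Y M P Q6 Q5 s0 s3 s4 s6 s5 hQ6 hQ5
    have hD' : (Y + s3) * (Y + s4) * (Y + s5) * (Y + s6) * M ^ 2
        - (2 * Y ^ 3 - 2 * (s0 - (s3 + s4 + s5 + s6)) * Y ^ 2 - (s0 * (s3 + s4 + s5 + s6)
            - (s3 * s4 + s3 * s5 + s3 * s6 + s4 * s5 + s4 * s6 + s5 * s6)) * Y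
            - (s0 * (s3 * s4 + s3 * s5 + s3 * s6 + s4 * s5 + s4 * s6 + s5 * s6)
              - (s3 * s4 * s5 + s3 * s4 * s6 + s3 * s5 * s6 + s4 * s5 * s6))) * M * P
        + (Y - s0) * (Y - s0 + (s3 + s4 + s5 + s6)) * P ^ 2 = 0 := by
      linear_combination hD
    rw [hD', neg_zero, hXQ5, hXQ6] at key
    have : Q5 * Q6 * ((X + s6) * P * (s3 + s4 + s6 - X') * (s0 - s6)
        - (X + Y) * M * (X' - s6) * ((s3 + s6) * (s4 + s6))) = 0 := by
      linear_combination (s0 - s6) * P * key - Q5 * M * (X' - s6) * ((s3 + s6) * (s4 + s6)) * hF2'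
    have := (mul_eq_zero.mp this).resolve_left hQQ
    linear_combination this

/-- **Non-degeneracy transfers.** If the twelve factors of the growth functional are non-zero at `(X, Y)`, the
constants `s₃+s₅, s₃+s₆, s₄+s₅, s₄+s₆` are non-zero, and `Y ≠ −s₅` (i.e. the image is not BZ's trivial solution
`(p₃′, 0)`), then the seven `X′`-dependent factors at the Möbius image are non-zero too (and so is `x′ = X′+s₅`). -/
theorem swap_newFactors_ne_zero {X Y X' s0 s1 s2 s3 s4 s5 s6 s7 : ℝ}
    (hF1 : (X + s6) * (s0 - X) * (s3 + s4 + s5 - X) * (X + Y) - (X - s3) * (X - s4) * (X - s5) * (X + Y + s6 - s0) = 0)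
    (hF2 : (Y + s6) * (s1 + s2 + s7 - Y) * (s0 - Y) * (X + Y) - (X + Y + s6 - s0) * (Y - s1) * (Y - s2) * (Y - s7) = 0)
    (h06 : s6 ≠ s0) (h05 : s5 ≠ s0) (hP : (Y - s1) * (Y - s2) * (Y - s7) ≠ 0) (hy : Y + s6 ≠ 0)
    (hX' : (X' + Y) * ((Y + s5) * ((s1 + s2 + s7 - Y) * (s0 - Y)) - (Y - s1) * (Y - s2) * (Y - s7))
      = (s5 - s0) * ((Y - s1) * (Y - s2) * (Y - s7)))
    (hM : (s1 + s2 + s7 - Y) * (s0 - Y) ≠ 0) (hv0 : X - s4 ≠ 0) (hv1 : X - s3 ≠ 0) (hv2 : X - s5 ≠ 0)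
    (hv3 : X + Y + s6 - s0 ≠ 0) (hv4 : s0 - X ≠ 0) (hv5 : s3 + s4 + s5 - X ≠ 0)
    (h35 : s3 + s5 ≠ 0) (h36 : s3 + s6 ≠ 0) (h45 : s4 + s5 ≠ 0) (h46 : s4 + s6 ≠ 0) (hy5 : Y + s5 ≠ 0) :
    X' - s4 ≠ 0 ∧ X' - s3 ≠ 0 ∧ X' - s6 ≠ 0 ∧ X' + Y + s5 - s0 ≠ 0 ∧ s0 - X' ≠ 0 ∧ s3 + s4 + s6 - X' ≠ 0
      ∧ X' + Y ≠ 0 ∧ X' + s5 ≠ 0 := by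
  obtain ⟨g0, g3, g4, g5, g6⟩ := swap_group_identities hF1 hF2 h06 h05 hP hy hX'
  have h05' : s0 - s5 ≠ 0 := fun h => h05 (by linear_combination -h)
  have h06' : s0 - s6 ≠ 0 := fun h => h06 (by linear_combination -h)
  -- `W′ ≠ 0`
  have hW : X' + Y ≠ 0 := by
    intro h0
    have : (s5 - s0) * ((Y - s1) * (Y - s2) * (Y - s7)) = 0 := by rw [← hX', h0, zero_mul]
    rcases mul_eq_zero.mp this with h | h
    · exact h05 (by linear_combination h)
    · exact hP h
  -- `v₃′ ≠ 0`: `v₃′·Q₅ = (s₅−s₀)(Y+s₅)M`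
  have hv3' : X' + Y + s5 - s0 ≠ 0 := by
    intro h0
    have e : (X' + Y + s5 - s0) * ((Y + s5) * ((s1 + s2 + s7 - Y) * (s0 - Y)) - (Y - s1) * (Y - s2) * (Y - s7))
        = (s5 - s0) * ((Y + s5) * ((s1 + s2 + s7 - Y) * (s0 - Y))) := by linear_combination hX'
    rw [h0, zero_mul] at e
    have := mul_ne_zero (sub_ne_zero.mpr h05) (mul_ne_zero hy5 hM)
    exact this e.symm
  -- `v₄′ ≠ 0` from G0
  have hv4' : s0 - X' ≠ 0 := by
    intro h0
    rw [h0, zero_mul, zero_mul] at g0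
    exact mul_ne_zero (mul_ne_zero hv3' hv4) h06' g0
  -- `v₅′ ≠ 0`, then `v₁′, v₀′ ≠ 0` from G3, G4
  have hv5' : s3 + s4 + s6 - X' ≠ 0 := by
    intro h0
    rw [h0, zero_mul, zero_mul] at g3
    have h1 : X' - s3 = 0 := by
      rcases mul_eq_zero.mp g3 with h | h
      · rcases mul_eq_zero.mp h with h' | h'
        · exact h'
        · exact absurd h' hv5
      · exact absurd h h36
    exact h46 (by linear_combination h0 + h1)
  have hv1' : X' - s3 ≠ 0 := by
    intro h0
    rw [h0, zero_mul, zero_mul] at g3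
    exact mul_ne_zero (mul_ne_zero hv5' hv1) h35 g3.symm
  have hv0' : X' - s4 ≠ 0 := by
    intro h0
    rw [h0, zero_mul, zero_mul] at g4
    exact mul_ne_zero (mul_ne_zero hv5' hv0) h45 g4.symm
  -- `x′ ≠ 0` from G5, `v₂′ ≠ 0` from G6 (with `x ≠ 0` from `F₁ = 0`)
  have hx' : X' + s5 ≠ 0 := by
    intro h0
    rw [h0, zero_mul, zero_mul, zero_mul] at g5
    exact mul_ne_zero (mul_ne_zero (mul_ne_zero hW hM) hv2) (mul_ne_zero h35 h45) g5.symm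
  have hx : X + s6 ≠ 0 := by
    intro h0
    rw [h0, zero_mul, zero_mul, zero_mul, zero_sub, neg_eq_zero] at hF1
    exact mul_ne_zero (mul_ne_zero (mul_ne_zero hv1 hv0) hv2) hv3 hF1
  have hv2' : X' - s6 ≠ 0 := by
    intro h0
    rw [h0, mul_zero, zero_mul] at g6
    exact mul_ne_zero (mul_ne_zero (mul_ne_zero hx hP) hv5') h06' g6
  exact ⟨hv0', hv1', hv2', hv3', hv4', hv5', hW, hx'⟩

end Summit.KontsevichZagierPeriods.Zeta5Search.Barrier.ConeGamma

end
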